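import Mathlib
import HarnessLib
import Summits.HubbardSuperconductivity.HubbardSuperconductivity.Theorems.KLProgrammeKLRegimeEngineScaleOneSrcWindowTimeMoment
import Summits.HubbardSuperconductivity.HubbardSuperconductivity.Theorems.KLProgrammeKLRegimeEngineScaleZeroE4TorusSums

/-!
# Route `KLProgramme` — K3 VL child (stmt-HubbardSuperconductivity-23356 `KLRegimeVolumeLimitV17F3`), atom HUV (`stub_vl_srcUV`, windowed currency HUV-W,
# pen (R295) «(VL)-HUV-CURRENCY»), part 2: TREE-WEIGHTED rows and columns of the WINDOWED source block and of the windowed doubled analysis `klSrcAnalysisAtW`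

Cell `gate-hubbard-kl`, seat p3 (g20).  The doubled one-step bound `EngineV8.srcPinnedSum_cutoff_le_of_wgridStep[_full]` (p671194) reads an output
matrix `T` on the doubled labels through its rows / columns weighted by the scale-`0` TREE WEIGHT
`gridLabelWt L (4M) β {srcLegPos X″, gridLegPos X′} = 1 + |τ″ − τ′|_β + |x⃗″ − x⃗′|_T` (physical imaginary-time distance plus torus distance).  For the
windowed analysis `T = klSrcAnalysisAtW L M β μ K J` (copy `0` = `E(F_J[K])`, copy `1` = the frequency-window block `E(F_χ)` in sector slot `0`) the
copy-`1` rows need the FIRST TIME MOMENT of the window kernel, which p3 g18's `windowBlock_wtRows_le` (spatial weight only) does not carry.  This file adds it: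

(Part 1, `…EngineScaleOneSrcWindowTimeMoment`: the first time moment of the window kernel and `srcWindowFamily_torusSum_gridWt_le` — the tree-weighted
torus sum of `F_χ` is `≤ T_χ = (M/β)·2(1 + 32c₂) + 8c₂(1 + log 4M)`.)
* §4 `wtRows_gridLabelWt_of_torusSum` — generic: tree-weighted rows `≤ T` and columns `≤ Ns·T` of `E(F)·S_{4M}` from that torus sum (the pattern of
  `EngineV8.kernelNormsWtAt_one_of_bounds`, exported once); `srcWindowFamily_wtRows_gridLabelWt_le` — the window block;
* §5 **`klSrcAnalysisAtW_wtRows_le`** — rows `≤ max cr₀ T_χ` and columns `≤ cc₀ + T_χ` of `klSrcAnalysisAtW L M β μ K J · S_{4M}` with positions `srcLegPos`,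
  from the copy-`0` rows / columns `(cr₀, cc₀)` of `E(F_J[K])·S_{4M}` — exactly the `hrow'` / `hcol'` inputs of p671194 for the windowed currency.

`T_χ` is `M`-uniform once `β(1 + log 4M) ≤ M` (the HUV binder order `… ∀ β …, ∃ M₁ …` allows it).  Proofs only; no definition; nothing asserts HUV, any stub,
VL, K3 or superconductivity.
[cite: BenfattoGiulianiMastropietro2006, §2.7 (2.70)–(2.71a), §3 (3.2)–(3.8)]
-/

noncomputable section

namespace Summit.HubbardSuperconductivity.HubbardSuperconductivity.Theorems.TwoVolumeSource

set_option linter.dupNamespace false -- summit = problem name (single-conjunct summit), D-0017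

open Finset Complex Literature.MathematicalPhysics.QuantumLattice GrassmannAlgebra Literature.Probability.LatticeModels
open Summit.HubbardSuperconductivity.HubbardSuperconductivity.Theorems.KLProgrammeLegKernels
open Summit.HubbardSuperconductivity.HubbardSuperconductivity.Theorems.KLRegimeSplit
open Summit.HubbardSuperconductivity.HubbardSuperconductivity.Theorems.EngineV8
open Summit.HubbardSuperconductivity.HubbardSuperconductivity.Theorems.TwoVolumeDefect
open scoped ComplexConjugate Real

/-! ## §4 Tree-weighted rows and columns of an overlap block from the tree-weighted torus sum -/

section Torus

variable {V M : ℕ} [NeZero V] [NeZero M]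

/-- **TREE-WEIGHTED ROWS AND COLUMNS OF `E(F)·S_{4M}` FROM ONE TREE-WEIGHTED TORUS SUM** (any multiplier family, `β > 0`): if
`(|β|V²)⁻¹ Σ_{(d,w⃗)} (1 + (β/4M)|d|_{4M} + |w⃗|_T)·‖Σ_k F_ω(k) Χ_c(k; d, w⃗)‖ ≤ T` for all `ω`, `c`, then every row of `E(F)·S_{4M}` weighted by
`gridLabelWt V (4M) β {latticeLegPos X″, gridLegPos X′}` is `≤ T` and every column `≤ Ns·T` (the bookkeeping of `EngineV8.kernelNormsWtAt_one_of_bounds`,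
exported for any family). [cite: BenfattoGiulianiMastropietro2006, §2.7 (2.71a)] -/
theorem wtRows_gridLabelWt_of_torusSum {Ns : ℕ} {β : ℝ} (hβ : 0 < β) (F : Fin Ns → FreqMomentum V M → ℂ) {T : ℝ}
    (hT : ∀ (ω : Fin Ns) (c : Fin 2), 1 / (|β| * (V : ℝ) ^ 2) *
        ∑ dw : TorusSite 1 (2 * (2 * M)) × TorusSite 2 V,
          (1 + (β / (2 * (2 * M) : ℕ) * cyclicDist (2 * (2 * M)) (dw.1 0) 0 + torusSiteDist dw.2 0)) *
            ‖∑ k : FreqMomentum V M, F ω k *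
              (if c = 0 then torusChar (fun _ : Fin 1 => ((k.1 : ℕ) : ZMod (2 * (2 * M)))) dw.1 * torusChar k.2 dw.2
                else conj (torusChar (fun _ : Fin 1 => ((k.1 : ℕ) : ZMod (2 * (2 * M)))) dw.1 * torusChar k.2 dw.2))‖ ≤ T) :
    (∀ X'' : SpaceTimeIdx V M × SectorLeg Ns, ∑ X' : GridLeg (GridPoint V (2 * (2 * M))),
        ‖(sectorAnalysisMatrix V M β F * hubbardGridSub V M β (2 * (2 * M))) X'' X'‖ *
          gridLabelWt V (2 * (2 * M)) β {latticeLegPos (2 * (2 * M)) X'', gridLegPos X'} ≤ T) ∧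
    (∀ X' : GridLeg (GridPoint V (2 * (2 * M))), ∑ X'' : SpaceTimeIdx V M × SectorLeg Ns,
        ‖(sectorAnalysisMatrix V M β F * hubbardGridSub V M β (2 * (2 * M))) X'' X'‖ *
          gridLabelWt V (2 * (2 * M)) β {latticeLegPos (2 * (2 * M)) X'', gridLegPos X'} ≤ Ns * T) := by
  classical
  set φ : TorusSite 1 (2 * (2 * M)) → TorusSite 2 V → ℝ := fun a bv =>
    1 + (β / (2 * (2 * M) : ℕ) * cyclicDist (2 * (2 * M)) (a 0) 0 + torusSiteDist bv 0) with hφ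
  have hφ0 : ∀ a bv, 0 ≤ φ a bv := fun a bv => scaleZeroMomentWeight_nonneg hβ.le a bv
  have hzero : ∀ (y : SpaceTimeIdx V M) (ω : Fin Ns) (σ c : Fin 2) (X' : GridLeg (GridPoint V (2 * (2 * M)))), (X'.1.2 ≠ σ ∨ X'.2 ≠ c) →
      (sectorAnalysisMatrix V M β F * hubbardGridSub V M β (2 * (2 * M))) (y, ((ω, σ), c)) X' = 0 := by
    intro y ω σ c X' h
    rw [sectorAnalysis_mul_hubbardGridSub_apply, if_neg]
    rintro ⟨h2, h3⟩
    rcases h with h | h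
    · exact h h2
    · exact h h3
  refine ⟨?_, ?_⟩
  · rintro ⟨y, ⟨⟨ω, σ⟩, c⟩⟩
    calc ∑ X' : GridLeg (GridPoint V (2 * (2 * M))),
          ‖(sectorAnalysisMatrix V M β F * hubbardGridSub V M β (2 * (2 * M))) (y, ((ω, σ), c)) X'‖ *
            gridLabelWt V (2 * (2 * M)) β {latticeLegPos (2 * (2 * M)) (y, ((ω, σ), c)), gridLegPos X'}
        = ∑ q : GridPoint V (2 * (2 * M)),
          ‖(sectorAnalysisMatrix V M β F * hubbardGridSub V M β (2 * (2 * M))) (y, ((ω, σ), c)) ((q, σ), c)‖ *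
            φ (fun _ : Fin 1 => ((q.1 : ℕ) : ZMod (2 * (2 * M))) - 2 * ((y.1 : ℕ) : ZMod (2 * (2 * M)))) (q.2 - y.2) := by
          rw [Fintype.sum_prod_type, Fintype.sum_prod_type]
          refine sum_congr rfl fun q _ => ?_
          rw [Fintype.sum_eq_single σ fun σ' hσ' => ?_, Fintype.sum_eq_single c fun c' hc' => ?_]
          · rw [gridLabelWt_pair_latticeLegPos_gridLegPos hβ.le]
          · rw [hzero y ω σ c ((q, σ), c') (Or.inr hc'), norm_zero, zero_mul]
          · exact sum_eq_zero fun c' _ => by rw [hzero y ω σ c ((q, σ'), c') (Or.inl hσ'), norm_zero, zero_mul]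
      _ ≤ T := rowSum_mul_sectorAnalysis_mul_hubbardGridSub_le_of_weight hβ.ne' _ φ hT ω σ c y
  · rintro ⟨⟨q, σ⟩, c⟩
    calc ∑ X'' : SpaceTimeIdx V M × SectorLeg Ns,
          ‖(sectorAnalysisMatrix V M β F * hubbardGridSub V M β (2 * (2 * M))) X'' ((q, σ), c)‖ *
            gridLabelWt V (2 * (2 * M)) β {latticeLegPos (2 * (2 * M)) X'', gridLegPos ((q, σ), c)}
        = ∑ ω : Fin Ns, ∑ y : SpaceTimeIdx V M,
          ‖(sectorAnalysisMatrix V M β F * hubbardGridSub V M β (2 * (2 * M))) (y, ((ω, σ), c)) ((q, σ), c)‖ *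
            φ (fun _ : Fin 1 => ((q.1 : ℕ) : ZMod (2 * (2 * M))) - 2 * ((y.1 : ℕ) : ZMod (2 * (2 * M)))) (q.2 - y.2) := by
          rw [Fintype.sum_prod_type, sum_comm, Fintype.sum_prod_type, Fintype.sum_prod_type]
          refine sum_congr rfl fun ω _ => ?_
          rw [Fintype.sum_eq_single σ fun σ' hσ' => ?_]
          · rw [Fintype.sum_eq_single c fun c' hc' => ?_]
            · exact sum_congr rfl fun y _ => by rw [gridLabelWt_pair_latticeLegPos_gridLegPos hβ.le]
            · exact sum_eq_zero fun y _ => by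
                rw [hzero y ω σ c' ((q, σ), c) (Or.inr (Ne.symm hc')), norm_zero, zero_mul]
          · exact sum_eq_zero fun c' _ => sum_eq_zero fun y _ => by
              rw [hzero y ω σ' c' ((q, σ), c) (Or.inl (Ne.symm hσ')), norm_zero, zero_mul]
      _ ≤ Ns * T := colSum_mul_sectorAnalysis_mul_hubbardGridSub_le_of_weight hβ.ne' _ φ hφ0 hT σ c q

/-- **THE WINDOW BLOCK HAS `M`-UNIFORM TREE-WEIGHTED ROWS AND COLUMNS UP TO `log M/M`**: rows and columns of `E(F_χ)·S_{4M}` weighted by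
`gridLabelWt V (4M) β {latticeLegPos X″, gridLegPos X′}` are `≤ (M/β)·2(1 + 32c₂) + 8c₂(1 + log 4M)`. [cite: BenfattoGiulianiMastropietro2006, §2.7 (2.71a)] -/
theorem srcWindowFamily_wtRows_gridLabelWt_le {β : ℝ} (hβ : 0 < β) {c₂ : ℝ} (hc₂ : ∀ x : ℝ, |iteratedDeriv 2 srcWindowFn x| ≤ c₂) :
    (∀ X'' : SpaceTimeIdx V M × SectorLeg 1, ∑ X' : GridLeg (GridPoint V (2 * (2 * M))),
        ‖(sectorAnalysisMatrix V M β (srcWindowFamily V M) * hubbardGridSub V M β (2 * (2 * M))) X'' X'‖ *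
          gridLabelWt V (2 * (2 * M)) β {latticeLegPos (2 * (2 * M)) X'', gridLegPos X'} ≤
        M / β * (2 * (1 + 32 * c₂)) + 8 * c₂ * (1 + Real.log (2 * (2 * M) : ℕ))) ∧
    (∀ X' : GridLeg (GridPoint V (2 * (2 * M))), ∑ X'' : SpaceTimeIdx V M × SectorLeg 1,
        ‖(sectorAnalysisMatrix V M β (srcWindowFamily V M) * hubbardGridSub V M β (2 * (2 * M))) X'' X'‖ *
          gridLabelWt V (2 * (2 * M)) β {latticeLegPos (2 * (2 * M)) X'', gridLegPos X'} ≤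
        M / β * (2 * (1 + 32 * c₂)) + 8 * c₂ * (1 + Real.log (2 * (2 * M) : ℕ))) := by
  have h := wtRows_gridLabelWt_of_torusSum (V := V) (M := M) hβ (srcWindowFamily V M) (srcWindowFamily_torusSum_gridWt_le hβ hc₂)
  simp only [Nat.cast_one, one_mul] at h
  exact h

end Torus

/-! ## §5 The windowed doubled analysis -/

section Doubled

variable {V M : ℕ} [NeZero V] [NeZero M]

/-- On a finite index type `Fin S`, the indicator of `val = 0` sums to at most one copy of a nonnegative constant. -/
theorem sum_fin_ite_val_zero_le (S : ℕ) {a : ℝ} (ha : 0 ≤ a) : ∑ sl : Fin S, (if (sl : ℕ) = 0 then a else 0) ≤ a := by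
  cases S with
  | zero => simp [ha]
  | succ S =>
    rw [Fin.sum_univ_succ]
    have h0 : (((0 : Fin (S + 1)) : ℕ) = 0) := rfl
    have hrest : ∑ i : Fin S, (if ((i.succ : Fin (S + 1)) : ℕ) = 0 then a else 0) = 0 :=
      Finset.sum_eq_zero fun i _ => if_neg (by rw [Fin.val_succ]; omega)
    rw [if_pos h0, hrest, add_zero]

/-- **TREE-WEIGHTED ROWS AND COLUMNS OF THE WINDOWED DOUBLED ANALYSIS** `klSrcAnalysisAtW V M β μ K J · S_{4M}` (positions `srcLegPos`): if the copy-`0`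
block `E(F_J[K])·S_{4M}` has tree-weighted rows `≤ cr₀` and columns `≤ cc₀`, then the doubled matrix has rows `≤ max cr₀ T_χ` and columns `≤ cc₀ + T_χ`,
`T_χ = (M/β)·2(1 + 32c₂) + 8c₂(1 + log 4M)` (copy `1` = the window block in sector slot `0`, dead rows elsewhere) — the `hrow'`/`hcol'` inputs of
`EngineV8.srcPinnedSum_cutoff_le_of_wgridStep[_full]` in the windowed currency. [cite: BenfattoGiulianiMastropietro2006, §2.7 (2.71a); Salmhofer1999, App. B.5.5] -/
theorem klSrcAnalysisAtW_wtRows_le {β : ℝ} (hβ : 0 < β) (μ : ℝ) (K : TrigPolyC4v) (J : ℕ) {c₂ : ℝ}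
    (hc₂ : ∀ x : ℝ, |iteratedDeriv 2 srcWindowFn x| ≤ c₂) {cr₀ cc₀ : ℝ}
    (hrow₀ : ∀ X'' : SpaceTimeIdx V M × SectorLeg (sectorCount J), ∑ X' : GridLeg (GridPoint V (2 * (2 * M))),
      ‖(sectorAnalysisMatrix V M β (klAnisoFamily V M β μ K klE0 J) * hubbardGridSub V M β (2 * (2 * M))) X'' X'‖ *
        gridLabelWt V (2 * (2 * M)) β {latticeLegPos (2 * (2 * M)) X'', gridLegPos X'} ≤ cr₀)
    (hcol₀ : ∀ X' : GridLeg (GridPoint V (2 * (2 * M))), ∑ X'' : SpaceTimeIdx V M × SectorLeg (sectorCount J),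
      ‖(sectorAnalysisMatrix V M β (klAnisoFamily V M β μ K klE0 J) * hubbardGridSub V M β (2 * (2 * M))) X'' X'‖ *
        gridLabelWt V (2 * (2 * M)) β {latticeLegPos (2 * (2 * M)) X'', gridLegPos X'} ≤ cc₀) :
    (∀ X'' : SrcLabel V M J, ∑ X' : GridLeg (GridPoint V (2 * (2 * M))),
        ‖(klSrcAnalysisAtW V M β μ K J * hubbardGridSub V M β (2 * (2 * M))) X'' X'‖ *
          gridLabelWt V (2 * (2 * M)) β {srcLegPos V M (2 * (2 * M)) X'', gridLegPos X'} ≤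
        max cr₀ (M / β * (2 * (1 + 32 * c₂)) + 8 * c₂ * (1 + Real.log (2 * (2 * M) : ℕ)))) ∧
    (∀ X' : GridLeg (GridPoint V (2 * (2 * M))), ∑ X'' : SrcLabel V M J,
        ‖(klSrcAnalysisAtW V M β μ K J * hubbardGridSub V M β (2 * (2 * M))) X'' X'‖ *
          gridLabelWt V (2 * (2 * M)) β {srcLegPos V M (2 * (2 * M)) X'', gridLegPos X'} ≤
        cc₀ + (M / β * (2 * (1 + 32 * c₂)) + 8 * c₂ * (1 + Real.log (2 * (2 * M) : ℕ)))) := by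
  classical
  have hM0 : (0 : ℝ) < M := Nat.cast_pos.2 (Nat.pos_of_ne_zero (NeZero.ne M))
  have hc0 : 0 ≤ c₂ := le_trans (abs_nonneg _) (hc₂ 0)
  set Tχ : ℝ := M / β * (2 * (1 + 32 * c₂)) + 8 * c₂ * (1 + Real.log (2 * (2 * M) : ℕ)) with hTχ
  have hlog0 : 0 ≤ Real.log (2 * (2 * M) : ℕ) := Real.log_nonneg (by
    have : (1 : ℝ) ≤ M := by exact_mod_cast Nat.pos_of_ne_zero (NeZero.ne M)
    push_cast
    linarith)
  have hTχ0 : 0 ≤ Tχ := by positivity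
  obtain ⟨hwr, hwc⟩ := srcWindowFamily_wtRows_gridLabelWt_le (V := V) (M := M) hβ hc₂
  set S := hubbardGridSub V M β (2 * (2 * M)) with hS
  set E₀ := sectorAnalysisMatrix V M β (klAnisoFamily V M β μ K klE0 J) with hE₀
  set Eχ := sectorAnalysisMatrix V M β (srcWindowFamily V M) with hEχ
  -- relabelling of a copy-`1` leg to the one-sector window leg
  set ρ : SpaceTimeIdx V M × SectorLeg (sectorCount J) → SpaceTimeIdx V M × SectorLeg 1 := fun Y => (Y.1, (((0 : Fin 1), Y.2.1.2), Y.2.2)) with hρ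
  -- entries of the doubled product
  have hmul0 : ∀ (Y : SpaceTimeIdx V M × SectorLeg (sectorCount J)) (X' : GridLeg (GridPoint V (2 * (2 * M)))),
      (klSrcAnalysisAtW V M β μ K J * S) (Y, 0) X' = (E₀ * S) Y X' := by
    intro Y X'
    simp only [Matrix.mul_apply, klSrcAnalysisAtW_apply, if_true, hE₀]
  have hmul1 : ∀ (Y : SpaceTimeIdx V M × SectorLeg (sectorCount J)) (X' : GridLeg (GridPoint V (2 * (2 * M)))),
      (klSrcAnalysisAtW V M β μ K J * S) (Y, 1) X' = if (Y.2.1.1 : ℕ) = 0 then (Eχ * S) (ρ Y) X' else 0 := by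
    intro Y X'
    by_cases h0 : (Y.2.1.1 : ℕ) = 0
    · simp only [Matrix.mul_apply, klSrcAnalysisAtW_apply, Fin.one_eq_zero_iff, OfNat.ofNat_ne_one, if_false, h0, if_true, hEχ, hρ]
    · simp only [Matrix.mul_apply, klSrcAnalysisAtW_apply, Fin.one_eq_zero_iff, OfNat.ofNat_ne_one, if_false, h0, zero_mul,
        Finset.sum_const_zero]
  -- positions: `srcLegPos (Y, i) = latticeLegPos Y = latticeLegPos (ρ Y)`
  have hpos : ∀ (Y : SpaceTimeIdx V M × SectorLeg (sectorCount J)) (i : Fin 2), srcLegPos V M (2 * (2 * M)) (Y, i) = latticeLegPos (2 * (2 * M)) Y :=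
    fun Y i => rfl
  have hposρ : ∀ Y : SpaceTimeIdx V M × SectorLeg (sectorCount J), latticeLegPos (2 * (2 * M)) (ρ Y) = latticeLegPos (2 * (2 * M)) Y :=
    fun Y => rfl
  refine ⟨?_, ?_⟩
  · rintro ⟨Y, i⟩
    obtain rfl | rfl : i = 0 ∨ i = 1 := by
      rcases Fin.exists_fin_two.mp ⟨i, rfl⟩ with h | h
      · exact Or.inl h
      · exact Or.inr h
    · -- copy `0`
      refine le_trans ?_ (le_max_left _ _)
      simp only [hmul0, hpos]
      exact hrow₀ Y
    · -- copy `1`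
      refine le_trans ?_ (le_max_right _ _)
      by_cases h0 : (Y.2.1.1 : ℕ) = 0
      · have hrw : ∀ X' : GridLeg (GridPoint V (2 * (2 * M))),
            ‖(klSrcAnalysisAtW V M β μ K J * S) (Y, 1) X'‖ * gridLabelWt V (2 * (2 * M)) β {srcLegPos V M (2 * (2 * M)) (Y, 1), gridLegPos X'} =
            ‖(Eχ * S) (ρ Y) X'‖ * gridLabelWt V (2 * (2 * M)) β {latticeLegPos (2 * (2 * M)) (ρ Y), gridLegPos X'} := fun X' => by
          rw [hmul1, if_pos h0, hpos, hposρ]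
        simp only [hrw]
        exact hwr (ρ Y)
      · have hrw : ∀ X' : GridLeg (GridPoint V (2 * (2 * M))),
            ‖(klSrcAnalysisAtW V M β μ K J * S) (Y, 1) X'‖ * gridLabelWt V (2 * (2 * M)) β {srcLegPos V M (2 * (2 * M)) (Y, 1), gridLegPos X'} = 0 :=
          fun X' => by rw [hmul1, if_neg h0, norm_zero, zero_mul]
        simp only [hrw, Finset.sum_const_zero]
        exact hTχ0
  · intro X'
    rw [Fintype.sum_prod_type_right, Fin.sum_univ_two]
    refine add_le_add ?_ ?_
    · simp only [hmul0, hpos]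
      exact hcol₀ X'
    · -- copy `1`: only sector slot `0` contributes, and it is the window block's column at the relabelled legs
      simp only [hmul1, hpos]
      have hterm : ∀ Y : SpaceTimeIdx V M × SectorLeg (sectorCount J),
          ‖(if (Y.2.1.1 : ℕ) = 0 then (Eχ * S) (ρ Y) X' else 0)‖ * gridLabelWt V (2 * (2 * M)) β {latticeLegPos (2 * (2 * M)) Y, gridLegPos X'} =
            if (Y.2.1.1 : ℕ) = 0 then ‖(Eχ * S) (ρ Y) X'‖ * gridLabelWt V (2 * (2 * M)) β {latticeLegPos (2 * (2 * M)) (ρ Y), gridLegPos X'} else 0 := by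
        intro Y
        split_ifs with h
        · rfl
        · rw [norm_zero, zero_mul]
      simp_rw [hterm]
      -- sum over `Y = (y, ((sl, σ), c))`: the slot indicator, then the one-sector column
      rw [Fintype.sum_prod_type]
      set H : SpaceTimeIdx V M → Fin 2 → Fin 2 → ℝ := fun y σ c =>
        ‖(Eχ * S) (y, (((0 : Fin 1), σ), c)) X'‖ * gridLabelWt V (2 * (2 * M)) β {latticeLegPos (2 * (2 * M)) (y, (((0 : Fin 1), σ), c)), gridLegPos X'} with hH
      have hH0 : ∀ y σ c, 0 ≤ H y σ c := fun y σ c =>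
        mul_nonneg (norm_nonneg _) (zero_le_one.trans (one_le_gridLabelWt V (2 * (2 * M)) β _))
      have hinner : ∀ y : SpaceTimeIdx V M, ∑ ℓ : SectorLeg (sectorCount J),
          (if (((y, ℓ) : SpaceTimeIdx V M × SectorLeg (sectorCount J)).2.1.1 : ℕ) = 0 then
            ‖(Eχ * S) (ρ (y, ℓ)) X'‖ * gridLabelWt V (2 * (2 * M)) β {latticeLegPos (2 * (2 * M)) (ρ (y, ℓ)), gridLegPos X'} else 0) ≤
          ∑ ℓ' : SectorLeg 1, ‖(Eχ * S) (y, ℓ') X'‖ * gridLabelWt V (2 * (2 * M)) β {latticeLegPos (2 * (2 * M)) (y, ℓ'), gridLegPos X'} := by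
        intro y
        have hL : ∑ ℓ : SectorLeg (sectorCount J),
            (if (((y, ℓ) : SpaceTimeIdx V M × SectorLeg (sectorCount J)).2.1.1 : ℕ) = 0 then
              ‖(Eχ * S) (ρ (y, ℓ)) X'‖ * gridLabelWt V (2 * (2 * M)) β {latticeLegPos (2 * (2 * M)) (ρ (y, ℓ)), gridLegPos X'} else 0) =
            ∑ sl : Fin (sectorCount J), ∑ σ : Fin 2, ∑ c : Fin 2, (if (sl : ℕ) = 0 then H y σ c else 0) := by
          simp only [Fintype.sum_prod_type, hρ, hH]
        have hR : ∑ ℓ' : SectorLeg 1, ‖(Eχ * S) (y, ℓ') X'‖ * gridLabelWt V (2 * (2 * M)) β {latticeLegPos (2 * (2 * M)) (y, ℓ'), gridLegPos X'} =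
            ∑ σ : Fin 2, ∑ c : Fin 2, H y σ c := by
          simp only [Fintype.sum_prod_type, Fin.sum_univ_one, hH]
        rw [hL, hR]
        -- `Σ_{sl} Σ_σ Σ_c [sl = 0]·H ≤ Σ_σ Σ_c H`
        calc ∑ sl : Fin (sectorCount J), ∑ σ : Fin 2, ∑ c : Fin 2, (if (sl : ℕ) = 0 then H y σ c else 0)
            = ∑ σ : Fin 2, ∑ sl : Fin (sectorCount J), ∑ c : Fin 2, (if (sl : ℕ) = 0 then H y σ c else 0) := Finset.sum_comm
          _ = ∑ σ : Fin 2, ∑ c : Fin 2, ∑ sl : Fin (sectorCount J), (if (sl : ℕ) = 0 then H y σ c else 0) :=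
              Finset.sum_congr rfl fun σ _ => Finset.sum_comm
          _ ≤ ∑ σ : Fin 2, ∑ c : Fin 2, H y σ c :=
              Finset.sum_le_sum fun σ _ => Finset.sum_le_sum fun c _ => sum_fin_ite_val_zero_le (sectorCount J) (hH0 y σ c)
      calc ∑ y : SpaceTimeIdx V M, ∑ ℓ : SectorLeg (sectorCount J),
            (if (((y, ℓ) : SpaceTimeIdx V M × SectorLeg (sectorCount J)).2.1.1 : ℕ) = 0 then
              ‖(Eχ * S) (ρ (y, ℓ)) X'‖ * gridLabelWt V (2 * (2 * M)) β {latticeLegPos (2 * (2 * M)) (ρ (y, ℓ)), gridLegPos X'} else 0)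
          ≤ ∑ y : SpaceTimeIdx V M, ∑ ℓ' : SectorLeg 1, ‖(Eχ * S) (y, ℓ') X'‖ * gridLabelWt V (2 * (2 * M)) β {latticeLegPos (2 * (2 * M)) (y, ℓ'), gridLegPos X'} :=
            Finset.sum_le_sum fun y _ => hinner y
        _ = ∑ X'' : SpaceTimeIdx V M × SectorLeg 1, ‖(Eχ * S) X'' X'‖ * gridLabelWt V (2 * (2 * M)) β {latticeLegPos (2 * (2 * M)) X'', gridLegPos X'} :=
            (Fintype.sum_prod_type (fun X'' : SpaceTimeIdx V M × SectorLeg 1 =>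
              ‖(Eχ * S) X'' X'‖ * gridLabelWt V (2 * (2 * M)) β {latticeLegPos (2 * (2 * M)) X'', gridLegPos X'})).symm
        _ ≤ Tχ := hwc X'

end Doubled

end Summit.HubbardSuperconductivity.HubbardSuperconductivity.Theorems.TwoVolumeSource

end
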